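import Summits.Ventures.HodgeRepro2.T5SU11JacobiLegendreLeading
import Summits.Ventures.HodgeRepro2.T5SU11SphericalLegendreLaplace
import Mathlib.RingTheory.Polynomial.ShiftedLegendre

/-!
# The bridge to Mathlib's shifted Legendre polynomials: `legShift n = (−1)ⁿ · shiftedLegendre n`,
`P_n(x) = Σ_{k ≤ n} C(n,k) C(n+k,n) ((x − 1)/2)^k`, and the explicit mixture coefficients of the phase law

The Legendre polynomials of this lane are DEFINED by Bonnet's recursion (`T5SU11SphericalLegendreAll.legP`,
`T5SU11JacobiPhaseLawEven.legPoly`) and identified with the spherical functions `φ_{2n+2}(a_t) = P_n(cosh 2t)`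
through the uniqueness theorem of the radial equation. Mathlib's `Polynomial.shiftedLegendre n ∈ ℤ[X]` is the
EXPLICIT sum `Σ_{k ≤ n} (−1)^k C(n,k) C(n+k,n) X^k`. This file identifies the two, again through the group:

* the explicit sum satisfies the shifted Legendre equation `x(1 − x) y'' + (1 − 2x) y' + n(n+1) y = 0` as a
  polynomial identity (`shiftedLegendreR_ode`), by the two-term ratio of its coefficients
  `(k+1)² a_{k+1} = (k − n)(k + n + 1) a_k` (`coeff_ratio`);
* hence `R_n(x) := P̃_n((1 − x)/2)` (`rod n`) satisfies Legendre's equation `(x² − 1) R'' + 2x R' = n(n+1) R`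
  (`rod_ode`), `R_n(1) = 1`, and `t ↦ R_n(cosh 2t)` solves the radial equation of parameter `λ = 2n + 2`, so by
  uniqueness (`T5SU11SphericalUnique.eq_sph_hyp_of_ode`) it IS `φ_{2n+2}(a_t) = P_n(cosh 2t)` (`rod_cosh_eq_sph_hyp`);
* two polynomials agreeing on `[1, ∞)` are equal: **`legPoly n = (shiftedLegendre n).comp ((1 − X)/2)`**
  (`legPoly_eq_rod`), and with Mathlib's reflection `(−1)ⁿ P̃_n(1 − X) = P̃_n`,
  **`legShift n = (−1)ⁿ · shiftedLegendre n`** (`legShift_eq`), i.e. **`c_{n,i} = (−1)^{n+i} C(n,i) C(n+i,n)`**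
  (`coeff_legShift`) — the coefficients left unidentified in `T5SU11JacobiPhaseLawEven`.

Consequences: the classical closed form **`P_n(x) = Σ_{k ≤ n} C(n,k) C(n+k,n) ((x − 1)/2)^k`** (`legP_eq_sum`), the
leading coefficient of the shifted polynomial is the central binomial coefficient `C(2n, n)` (`coeff_legShift_self`,
cross-checked against `T5SU11JacobiLegendreLeading.legLead`: `2ⁿ · (2n)!/(2ⁿ n!²) = C(2n, n)`, `legLead_mul_two_pow`),
Rodrigues' formula for the shifted polynomial **`n! · legShift n = (−1)ⁿ Dⁿ(Xⁿ(1 − X)ⁿ)`** (`rodrigues_legShift`),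
and the phase law at `λ = 2n + 2` with EXPLICIT coefficients:
**`Φ_{2n+2}(s) = Σ_{i ≤ n} (−1)^{n+i} C(n,i) C(n+i,n) e^{2is}`** (`sphPhase_even_eq_sum_explicit`),
**`m̂_k(2n+2) = 2π Σ_{i ≤ n} (−1)^{n+i} C(n,i) C(n+i,n)/(k − 2 − 2i)`** (`jacobi_even_eq_explicit`),
recovering `c = (−1, 2)` at `n = 1` and `c = (1, −6, 6)` at `n = 2`. Nothing is claimed about (N).

Blind lane: Mathlib + the HodgeRepro2 prefix only; no sorry; axioms ⊆ {propext, Classical.choice,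
Quot.sound}.
-/

namespace Summit.Ventures.HodgeRepro2.T5SU11LegendreShiftedBridge

open MeasureTheory Metric Set Filter Topology Polynomial Finset
open T5SU11Unimodular T5SU11Fibration T5SU11Cartan T5SU11OneParameter T5SU11CartanProjection T5HaarCircle
  T5BergmanCoefficient T5SU11FibrationHaar T5SU11SphericalFunction T5SU11SphericalUnique
  T5SU11SphericalLegendreHigher T5SU11SphericalLegendreAll T5SU11JacobiLaplacePhase T5SU11JacobiPhaseLawInteger
  T5SU11JacobiPhaseLawEven T5SU11JacobiLegendreLeading T5SU11SphericalLegendreLaplace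
open scoped Real

/-! ### Mathlib's shifted Legendre polynomial with real coefficients -/

/-- **Mathlib's shifted Legendre polynomial `P̃_n = Σ_{k ≤ n} (−1)^k C(n,k) C(n+k,n) X^k`, with real coefficients.** -/
noncomputable def shiftedLegendreR (n : ℕ) : ℝ[X] := (shiftedLegendre n).map (Int.castRingHom ℝ)

/-- The coefficients `a_k = (−1)^k C(n,k) C(n+k,n)`. -/
theorem coeff_shiftedLegendreR (n k : ℕ) :
    (shiftedLegendreR n).coeff k = (-1) ^ k * (n.choose k : ℝ) * ((n + k).choose n : ℝ) := by
  rw [shiftedLegendreR, coeff_map, coeff_shiftedLegendre, eq_intCast]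
  push_cast
  ring

/-- `natDegree P̃_n = n`. -/
theorem natDegree_shiftedLegendreR (n : ℕ) : (shiftedLegendreR n).natDegree = n := by
  rw [shiftedLegendreR, natDegree_map_eq_of_injective (Int.castRingHom ℝ).injective_int,
    natDegree_shiftedLegendre]

/-- `P̃_n(0) = 1`. -/
theorem coeff_shiftedLegendreR_zero (n : ℕ) : (shiftedLegendreR n).coeff 0 = 1 := by
  rw [coeff_shiftedLegendreR]
  simp

/-- **The two-term ratio of consecutive coefficients**: `(k + 1)² a_{k+1} = (k − n)(k + n + 1) a_k`. -/
theorem coeff_ratio (n k : ℕ) :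
    ((k : ℝ) + 1) ^ 2 * (shiftedLegendreR n).coeff (k + 1)
      = ((k : ℝ) - n) * ((k : ℝ) + n + 1) * (shiftedLegendreR n).coeff k := by
  rw [coeff_shiftedLegendreR, coeff_shiftedLegendreR]
  rcases lt_or_ge k n with hk | hk
  · -- `k < n`: `(k+1) C(n,k+1) = (n−k) C(n,k)` and `(k+1) C(n+k+1,n) = (n+k+1) C(n+k,n)`
    have h1 : (n.choose (k + 1) : ℝ) * ((k : ℝ) + 1) = (n.choose k : ℝ) * ((n : ℝ) - k) := by
      have := congrArg (Nat.cast (R := ℝ)) (Nat.choose_succ_right_eq n k)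
      push_cast [Nat.cast_sub hk.le] at this
      exact this
    have h2 : ((n + (k + 1)).choose n : ℝ) * ((k : ℝ) + 1) = ((n + k).choose n : ℝ) * ((n : ℝ) + k + 1) := by
      have hs1 : (n + k).choose n = (n + k).choose k := Nat.choose_symm_add
      have hs2 : (n + (k + 1)).choose n = (n + (k + 1)).choose (k + 1) := Nat.choose_symm_add
      have := congrArg (Nat.cast (R := ℝ)) (Nat.add_one_mul_choose_eq (n + k) k)
      rw [hs1, hs2]
      push_cast at this
      rw [show n + (k + 1) = n + k + 1 by ring]
      linarith
    linear_combination (-((-1 : ℝ) ^ k) * ((n + (k + 1)).choose n : ℝ) * ((k : ℝ) + 1)) * h1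
      + (-((-1 : ℝ) ^ k) * (n.choose k : ℝ) * ((n : ℝ) - k)) * h2
  · rcases hk.eq_or_lt with rfl | hk'
    · simp [Nat.choose_succ_self]
    · simp [Nat.choose_eq_zero_of_lt hk', Nat.choose_eq_zero_of_lt (hk'.trans (Nat.lt_succ_self k))]

/-! ### The shifted Legendre equation, as a polynomial identity -/

/-- **The shifted Legendre equation** `x(1 − x) y'' + (1 − 2x) y' + n(n + 1) y = 0` for `P̃_n`, in `ℝ[X]`. -/
theorem shiftedLegendreR_ode (n : ℕ) :
    X * (1 - X) * derivative (derivative (shiftedLegendreR n))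
      + (1 - C (2 : ℝ) * X) * derivative (shiftedLegendreR n)
      + C ((n : ℝ) * (n + 1)) * shiftedLegendreR n = 0 := by
  set p := shiftedLegendreR n with hp
  have key : ∀ k : ℕ, ((k : ℝ) + 1) ^ 2 * p.coeff (k + 1) = ((k : ℝ) - n) * ((k : ℝ) + n + 1) * p.coeff k :=
    coeff_ratio n
  have e : X * (1 - X) * derivative (derivative p) + (1 - C (2 : ℝ) * X) * derivative p
      + C ((n : ℝ) * (n + 1)) * p
      = X * derivative (derivative p) - X ^ 2 * derivative (derivative p) + derivative p
        - C (2 : ℝ) * (X * derivative p) + C ((n : ℝ) * (n + 1)) * p := by ring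
  rw [e]
  ext k
  simp only [coeff_add, coeff_sub, coeff_zero, coeff_C_mul]
  rcases k with _ | _ | k
  · simp only [coeff_X_mul_zero, coeff_X_pow_mul', coeff_derivative, Nat.cast_zero]
    simp only [show ¬ (2 ≤ 0) by norm_num, if_false]
    have := key 0
    push_cast at this
    linear_combination this
  · simp only [coeff_X_mul, coeff_X_pow_mul', coeff_derivative, Nat.cast_zero]
    simp only [show ¬ (2 ≤ 1) by norm_num, if_false]
    have := key 1
    push_cast at this
    linear_combination this
  · have h2 : (X ^ 2 * derivative (derivative p)).coeff (k + 1 + 1)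
        = (derivative (derivative p)).coeff k := coeff_X_pow_mul _ 2 k
    rw [h2]
    simp only [coeff_X_mul, coeff_derivative]
    push_cast
    have := key (k + 2)
    push_cast at this
    linear_combination this

/-- The shifted Legendre equation, evaluated: `y(1 − y) f''(y) + (1 − 2y) f'(y) + n(n + 1) f(y) = 0` with
`f = eval · P̃_n`. -/
theorem shiftedLegendreR_ode_eval (n : ℕ) (y : ℝ) :
    y * (1 - y) * (derivative (derivative (shiftedLegendreR n))).eval y
      + (1 - 2 * y) * (derivative (shiftedLegendreR n)).eval y
      + (n : ℝ) * (n + 1) * (shiftedLegendreR n).eval y = 0 := by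
  have := congrArg (eval y) (shiftedLegendreR_ode n)
  simpa [eval_add, eval_mul, eval_sub, eval_X, eval_C, eval_one] using this

/-! ### `R_n(x) = P̃_n((1 − x)/2)` solves Legendre's equation and is `P_n` -/

/-- **`R_n := P̃_n ∘ ((1 − X)/2)`**, the candidate for `P_n`. -/
noncomputable def rod (n : ℕ) : ℝ[X] := (shiftedLegendreR n).comp (C (1 / 2 : ℝ) - C (1 / 2 : ℝ) * X)

/-- `R_n(x) = P̃_n((1 − x)/2)`. -/
theorem rod_eval (n : ℕ) (x : ℝ) : (rod n).eval x = (shiftedLegendreR n).eval ((1 - x) / 2) := by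
  rw [rod, eval_comp, eval_sub, eval_mul, eval_C, eval_X]
  ring_nf

/-- `R_n(1) = 1`. -/
theorem rod_eval_one (n : ℕ) : (rod n).eval 1 = 1 := by
  rw [rod_eval, sub_self, zero_div, ← coeff_zero_eq_eval_zero, coeff_shiftedLegendreR_zero]

/-- The derivatives of `x ↦ R_n(x) = f((1 − x)/2)`. -/
theorem hasDerivAt_rod (n : ℕ) (x : ℝ) :
    HasDerivAt (fun x : ℝ => (shiftedLegendreR n).eval ((1 - x) / 2))
      (-(1 / 2) * (derivative (shiftedLegendreR n)).eval ((1 - x) / 2)) x := by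
  have h := (Polynomial.hasDerivAt (shiftedLegendreR n) ((1 - x) / 2)).comp x
    (((hasDerivAt_id' x).const_sub 1).div_const 2)
  refine h.congr_deriv ?_
  ring

/-- The second derivative of `x ↦ R_n(x)`: `R_n'' = f''((1 − x)/2)/4`. -/
theorem hasDerivAt_rod' (n : ℕ) (x : ℝ) :
    HasDerivAt (fun x : ℝ => -(1 / 2) * (derivative (shiftedLegendreR n)).eval ((1 - x) / 2))
      ((1 / 4) * (derivative (derivative (shiftedLegendreR n))).eval ((1 - x) / 2)) x := by
  have h := ((Polynomial.hasDerivAt (derivative (shiftedLegendreR n)) ((1 - x) / 2)).comp x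
    (((hasDerivAt_id' x).const_sub 1).div_const 2)).const_mul (-(1 / 2 : ℝ))
  refine h.congr_deriv ?_
  ring

/-- **Legendre's equation for `R_n`**: `(x² − 1) R_n'' + 2x R_n' = n(n + 1) R_n`. -/
theorem rod_ode (n : ℕ) (x : ℝ) :
    (x ^ 2 - 1) * ((1 / 4) * (derivative (derivative (shiftedLegendreR n))).eval ((1 - x) / 2))
      + 2 * x * (-(1 / 2) * (derivative (shiftedLegendreR n)).eval ((1 - x) / 2))
      = (n : ℝ) * (n + 1) * (shiftedLegendreR n).eval ((1 - x) / 2) := by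
  have h := shiftedLegendreR_ode_eval n ((1 - x) / 2)
  linear_combination (-1 : ℝ) * h

section measure

variable [MeasurableSpace Circle] [BorelSpace Circle]

/-- **`R_n(cosh 2t) = φ_{2n+2}(a_t)`**: `t ↦ R_n(cosh 2t)` solves the radial equation of parameter `2n + 2` with
value `1` at `t = 0`, so it is the spherical function by uniqueness. -/
theorem rod_cosh_eq_sph_hyp (n : ℕ) (t : ℝ) :
    (shiftedLegendreR n).eval ((1 - Real.cosh (2 * t)) / 2) = sph (2 * (n : ℝ) + 2) (hyp t) := by
  refine eq_sph_hyp_of_ode (2 * (n : ℝ) + 2)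
    (v := fun t => (shiftedLegendreR n).eval ((1 - Real.cosh (2 * t)) / 2))
    (v' := fun t => 2 * Real.sinh (2 * t)
      * (-(1 / 2) * (derivative (shiftedLegendreR n)).eval ((1 - Real.cosh (2 * t)) / 2)))
    (v'' := fun t => 4 * Real.cosh (2 * t)
        * (-(1 / 2) * (derivative (shiftedLegendreR n)).eval ((1 - Real.cosh (2 * t)) / 2))
      + 4 * Real.sinh (2 * t) ^ 2
        * ((1 / 4) * (derivative (derivative (shiftedLegendreR n))).eval ((1 - Real.cosh (2 * t)) / 2)))
    (fun t => ?_) (fun t => ?_) (fun t => ?_) ?_ t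
  · have h := (hasDerivAt_rod n (Real.cosh (2 * t))).comp t (hasDerivAt_cosh_two_mul_self t)
    refine h.congr_deriv ?_
    ring
  · have h := (hasDerivAt_sinh_two_mul_self t).const_mul 2 |>.mul
      ((hasDerivAt_rod' n (Real.cosh (2 * t))).comp t (hasDerivAt_cosh_two_mul_self t))
    refine h.congr_deriv ?_
    simp only [Function.comp_apply]
    ring
  · have hode := rod_ode n (Real.cosh (2 * t))
    have hcs : Real.sinh (2 * t) ^ 2 = Real.cosh (2 * t) ^ 2 - 1 := by
      have := Real.cosh_sq (2 * t)
      linarith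
    rw [hcs]
    linear_combination (4 * Real.sinh (2 * t)) * hode
  · simp only [mul_zero, Real.cosh_zero, sub_self, zero_div]
    rw [← coeff_zero_eq_eval_zero, coeff_shiftedLegendreR_zero]

end measure

/-- **`R_n(x) = P_n(x)` for `x ≥ 1`** (through the group; no measurable structure remains in the statement). -/
theorem rod_eval_eq_legP (n : ℕ) {x : ℝ} (hx : 1 ≤ x) : (rod n).eval x = legP n x := by
  letI : MeasurableSpace Circle := borel Circle
  haveI : BorelSpace Circle := ⟨rfl⟩
  obtain ⟨t, -, ht⟩ := exists_cosh_two_mul_eq hx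
  rw [rod_eval, ← ht, rod_cosh_eq_sph_hyp, sph_even_hyp]

/-- **THE BRIDGE: `legPoly n = P̃_n ∘ ((1 − X)/2)`** — Bonnet's polynomials are Mathlib's explicit sums. -/
theorem legPoly_eq_rod (n : ℕ) : legPoly n = rod n := by
  refine Polynomial.eq_of_infinite_eval_eq _ _ ((Set.Ici_infinite (1 : ℝ)).mono fun x hx => ?_)
  show (legPoly n).eval x = (rod n).eval x
  rw [← legP_eq_eval, rod_eval_eq_legP n (mem_Ici.mp hx)]

/-- **`P_n(x) = P̃_n((1 − x)/2)`** for every real `x`. -/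
theorem legP_eq_shiftedLegendreR_eval (n : ℕ) (x : ℝ) :
    legP n x = (shiftedLegendreR n).eval ((1 - x) / 2) := by
  rw [legP_eq_eval, legPoly_eq_rod, rod_eval]

/-- **The classical closed form `P_n(x) = Σ_{k ≤ n} C(n,k) C(n+k,n) ((x − 1)/2)^k`.** -/
theorem legP_eq_sum (n : ℕ) (x : ℝ) :
    legP n x = ∑ k ∈ range (n + 1), (n.choose k : ℝ) * ((n + k).choose n : ℝ) * ((x - 1) / 2) ^ k := by
  rw [legP_eq_shiftedLegendreR_eval,
    eval_eq_sum_range' (lt_of_le_of_lt (natDegree_shiftedLegendreR n).le (Nat.lt_succ_self n))]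
  refine Finset.sum_congr rfl fun k _ => ?_
  rw [coeff_shiftedLegendreR, show (x - 1) / 2 = (-1) * ((1 - x) / 2) by ring, mul_pow]
  ring

/-- The same with the sign inside: `P_n(x) = Σ_{k ≤ n} (−1)^k C(n,k) C(n+k,n) ((1 − x)/2)^k`. -/
theorem legP_eq_sum' (n : ℕ) (x : ℝ) :
    legP n x = ∑ k ∈ range (n + 1), (-1) ^ k * (n.choose k : ℝ) * ((n + k).choose n : ℝ) * ((1 - x) / 2) ^ k := by
  rw [legP_eq_sum]
  refine Finset.sum_congr rfl fun k _ => ?_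
  rw [show (x - 1) / 2 = (-1) * ((1 - x) / 2) by ring, mul_pow]
  ring

/-! ### The shifted polynomial of `T5SU11JacobiPhaseLawEven` is `(−1)ⁿ P̃_n` -/

/-- Mathlib's reflection `(−1)ⁿ P̃_n(1 − X) = P̃_n`, with real coefficients. -/
theorem shiftedLegendreR_comp_one_sub (n : ℕ) :
    (shiftedLegendreR n).comp (1 - X) = (-1) ^ n * shiftedLegendreR n := by
  have h := congrArg (Polynomial.map (Int.castRingHom ℝ)) (neg_one_pow_mul_shiftedLegendre_comp_one_sub_X_eq n)
  rw [Polynomial.map_mul, Polynomial.map_pow, Polynomial.map_neg, Polynomial.map_one, Polynomial.map_comp,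
    Polynomial.map_sub, Polynomial.map_one, Polynomial.map_X] at h
  have hsq : ((-1 : ℝ[X]) ^ n) * ((-1 : ℝ[X]) ^ n) = 1 := by
    rw [← pow_add, ← two_mul, pow_mul]
    simp
  calc (shiftedLegendreR n).comp (1 - X)
      = ((-1 : ℝ[X]) ^ n * (-1 : ℝ[X]) ^ n) * ((shiftedLegendre n).map (Int.castRingHom ℝ)).comp (1 - X) := by
        rw [hsq, one_mul, shiftedLegendreR]
    _ = (-1) ^ n * shiftedLegendreR n := by rw [mul_assoc, h, shiftedLegendreR]

/-- **`legShift n = (−1)ⁿ · P̃_n`**: the shifted polynomial `P_n(2X − 1)` of the phase law is Mathlib's shifted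
Legendre polynomial up to the sign `(−1)ⁿ`. -/
theorem legShift_eq (n : ℕ) : legShift n = (-1) ^ n * shiftedLegendreR n := by
  rw [legShift, legPoly_eq_rod, rod, comp_assoc, ← shiftedLegendreR_comp_one_sub]
  congr 1
  rw [sub_comp, mul_comp, C_comp, X_comp]
  ext k
  rcases k with _ | _ | k
  · norm_num [coeff_X, coeff_C, coeff_one]
  · norm_num [coeff_X, coeff_C, coeff_one]
  · norm_num [coeff_X, coeff_C, coeff_one]

/-- **`c_{n,i} = (−1)^{n+i} C(n,i) C(n+i,n)`** — the coefficients of the phase law at `λ = 2n + 2`, identified. -/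
theorem coeff_legShift (n i : ℕ) :
    (legShift n).coeff i = (-1) ^ (n + i) * (n.choose i : ℝ) * ((n + i).choose n : ℝ) := by
  rw [legShift_eq, show ((-1 : ℝ[X]) ^ n) = C ((-1 : ℝ) ^ n) by simp, coeff_C_mul, coeff_shiftedLegendreR,
    pow_add]
  ring

/-- The leading coefficient of `legShift n` is the central binomial coefficient `C(2n, n)`. -/
theorem coeff_legShift_self (n : ℕ) : (legShift n).coeff n = ((2 * n).choose n : ℝ) := by
  rw [coeff_legShift, ← two_mul, pow_mul, neg_one_sq, one_pow, one_mul, Nat.choose_self, Nat.cast_one, one_mul]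

/-- Cross-check with `T5SU11JacobiLegendreLeading.legLead`: `2ⁿ · (2n)!/(2ⁿ n!²) = C(2n, n)`. -/
theorem legLead_mul_two_pow (n : ℕ) : legLead n * 2 ^ n = ((2 * n).choose n : ℝ) := by
  have h := Nat.choose_mul_factorial_mul_factorial (show n ≤ 2 * n by omega)
  rw [show 2 * n - n = n by omega] at h
  have h' : ((2 * n).choose n : ℝ) * (n.factorial : ℝ) * (n.factorial : ℝ) = ((2 * n).factorial : ℝ) := by
    exact_mod_cast h
  rw [legLead, div_mul_eq_mul_div, div_eq_iff (by positivity)]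
  linear_combination (-(2 : ℝ) ^ n) * h'

/-- The leading coefficient of `legShift n` is `2ⁿ · legLead n` — the two descriptions of the degree-`n` term agree. -/
theorem coeff_legShift_self' (n : ℕ) : (legShift n).coeff n = legLead n * 2 ^ n := by
  rw [coeff_legShift_self, legLead_mul_two_pow]

/-- **Rodrigues' formula for the shifted polynomial**: `n! · legShift n = (−1)ⁿ Dⁿ(Xⁿ(1 − X)ⁿ)`. -/
theorem rodrigues_legShift (n : ℕ) :
    (n.factorial : ℝ[X]) * legShift n = (-1) ^ n * derivative^[n] (X ^ n * (1 - X) ^ n) := by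
  have h := congrArg (Polynomial.map (Int.castRingHom ℝ)) (factorial_mul_shiftedLegendre_eq n)
  rw [Polynomial.map_mul, Polynomial.map_natCast, ← iterate_derivative_map, Polynomial.map_mul,
    Polynomial.map_pow, Polynomial.map_pow, Polynomial.map_sub, Polynomial.map_one, Polynomial.map_X] at h
  have h' : (n.factorial : ℝ[X]) * shiftedLegendreR n = derivative^[n] (X ^ n * (1 - X) ^ n) := h
  rw [legShift_eq, mul_left_comm, h']

/-! ### The phase law at `λ = 2n + 2` with explicit coefficients -/

section measure

variable [MeasurableSpace Circle] [BorelSpace Circle]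

/-- **`Φ_{2n+2}(s) = Σ_{i ≤ n} (−1)^{n+i} C(n,i) C(n+i,n) e^{2is}`** for `s ≥ 0`. -/
theorem sphPhase_even_eq_sum_explicit (n : ℕ) {s : ℝ} (hs : 0 ≤ s) :
    sphPhase (2 * (n : ℝ) + 2) s
      = ∑ i ∈ range (n + 1),
          (-1) ^ (n + i) * (n.choose i : ℝ) * ((n + i).choose n : ℝ) * Real.exp (2 * (i : ℝ) * s) := by
  rw [sphPhase_even_eq_sum n hs]
  refine Finset.sum_congr rfl fun i _ => ?_
  rw [coeff_legShift]

/-- **`m̂_k(2n + 2) = 2π Σ_{i ≤ n} (−1)^{n+i} C(n,i) C(n+i,n)/(k − 2 − 2i)`** for `k > 2n + 2`. -/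
theorem jacobi_even_eq_explicit (n : ℕ) {k : ℝ} (hk : 2 * (n : ℝ) + 2 < k) :
    ∫ g, (1 - ‖orbit g‖ ^ 2) ^ (k / 2) * sph (2 * (n : ℝ) + 2) g ∂(nu haarCircle)
      = 2 * π * ∑ i ∈ range (n + 1),
          (-1) ^ (n + i) * (n.choose i : ℝ) * ((n + i).choose n : ℝ) / (k - 2 - 2 * (i : ℝ)) := by
  rw [jacobi_even_eq n hk]
  congr 1
  refine Finset.sum_congr rfl fun i _ => ?_
  rw [coeff_legShift]

end measure

/-- The cross-check `n = 1`: `c_{1,0} = −1` (`T5SU11JacobiPhaseLawInteger.tail_four_eq` has `c = (−1, 2)`). -/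
theorem coeff_legShift_one_zero : (legShift 1).coeff 0 = -1 := by
  rw [coeff_legShift]; norm_num

/-- The cross-check `n = 1`: `c_{1,1} = 2`. -/
theorem coeff_legShift_one_one : (legShift 1).coeff 1 = 2 := by
  rw [coeff_legShift]; norm_num

/-- The cross-check `n = 2`: `c_{2,0} = 1` (`tail_six_eq` has `c = (1, −6, 6)`). -/
theorem coeff_legShift_two_zero : (legShift 2).coeff 0 = 1 := by
  rw [coeff_legShift]; norm_num

/-- The cross-check `n = 2`: `c_{2,1} = −6`. -/
theorem coeff_legShift_two_one : (legShift 2).coeff 1 = -6 := by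
  rw [coeff_legShift]; norm_num [Nat.choose]

/-- The cross-check `n = 2`: `c_{2,2} = 6`. -/
theorem coeff_legShift_two_two : (legShift 2).coeff 2 = 6 := by
  rw [coeff_legShift]; norm_num [Nat.choose]

end Summit.Ventures.HodgeRepro2.T5SU11LegendreShiftedBridge
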